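import Summits.QuantumFields.BalabanUV.T4Continuum.Support.NE7LinOneStepAbelianSup
import Summits.QuantumFields.BalabanUV.T4Continuum.Support.NE7LinOneStepGaugeCovariance
import Summits.QuantumFields.BalabanUV.T4Continuum.Support.NE7TorusConeGaugePoincare
import Literature.MathematicalPhysics.QuantumFieldTheory.Balaban1983to89.B6Geom246MultiLevelTorus
import HarnessLib

/-!
# NE7LinOneStepAbelian — LIN-ONE-STEP IN KERNEL: in the abelian flat model THE CURVATURE OF THE CONSTRAINED LANDAU MINIMISER `H_kB` IS
# BOUNDED POINTWISE BY THE SUP OF THE CURVATURE OF THE DATUM, `sup|F(H_kB)| ≤ C_LIN(d)·sup|F(B)|`, UNIFORMLY IN THE LEVEL `n = L^k` AND THE VOLUME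

Cell `pub-balaban`, rung (B)+1 sub-cell t4, lineage `b2b-balaban-t4-ne7-p1`, generation 65 (CRUX PROVER NE7 #1, ruling e34b3e0c (2)); hunt
(h8) «REGULARITY ROAD», step (h8-ii) (memo `t4/b2b-balaban-t4-ne7-p1-g64/HUNT-H8-REGULARITY-ROAD.md` §1, §4).  File C of A ∕ B1 ∕ B2a ∕ B2b ∕ C.

THE POINT.  After gen 64 route 1's (A)-bill at curved data is X-A4 ∧ ONE-STEP, ONE-STEP = [Balaban1985Variational] Thm 1 GIVEN AN ADMISSIBLE
COMPETITOR: the constrained minimiser over the small-field class one level up lies in the class of radius `B₃ε₁η²` — the datum's curvature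
`ε₁` times a constant of `d, L` ONLY ((8) p. 279), not the competitor's `C₁B₃ε₁` ((13)–(14) p. 280, `C₁ = L³`).  The abelian flat image of
this «even spreading of the coarse flux» is the statement of THIS FILE for lit-balaban's typed Landau minimiser `H_k = B5Hk163Torus.HkOp n M`
((1.63) of [Balaban1984PropagatorsI]; `Q_kH_k = 1`, Landau gauge, minimiser of `½Σ|F|²` on the fibre — all kernel theorems of the cell
`lit-balaban`):
* **`norm_curl_HkOp_le_curl`** — for every coarse field `B` on `T₁ = Π_μ ℤ∕M_μ` with `|F_{μν}(B)(y)| ≤ f` (unit lattice) and every fine point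
  `x ∈ T_η`, `|F_{μν}(H_kB)(x)| ≤ C_LIN(d)·f` (fine lattice, factor `η⁻¹ = n`), `C_LIN(d) = 2(d+1)·CdecD(d)·(2(d+1))·(2 + 32∕κ′²)·K_{d+1}(κ′∕2)`,
  `κ′ = κ₁₆₃(d+1)∕(d+1)` — constants of the dimension ONLY: uniform in `n = L^k` and in the period vector `M`;
* `norm_curl_le_sup_curl_HkOp` — the converse `sup|F¹(B)| ≤ sup|F^η(H_kB)|` with constant `1` (sup form of Federbush's abelian stability for
  the typed `Q_k`, lit-balaban's `B5AverageCurlStokes`, and `Q_kH_k = 1`): the two curvatures are COMPARABLE.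
Contrast: gen 64's `NE7LinOneStepAbelianSup.norm_curl_HkOp_mulVec_le_sup` has `sup|B|` on the right — the abelian image of B11's (46)
(= Thm 3.12 of B11's ref. [5] = [Balaban1985BackgroundPropagators], CMP 99), the «worse bound» of Sects. C–E; the improvement to the CURVATURE of the datum is B11 Sect. F, whose three
ingredients are here the three imported files: GAUGE COVARIANCE of `curl H_k` (file A `NE7LinOneStepGaugeCovariance.Fs_HkOp_eq_of_sub_eq`:
exact and constant data have flat minimisers), LOCALITY (the exponentially decaying derivative kernel, lit-balaban's
`B5Hk163TorusHolderDecay.norm_dker_bpt_le` = [Balaban1984PropagatorsII] Cor. 2.8 (2.151)), and the CONE GAUGE with polynomial growth (file B2b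
`NE7TorusConeGaugePoincare.coneGauge_exists`, the torus image of (145) p. 301): `curl H_kB = curl H_kB′` with `|B′(y)| ≤ 2(d+1)(1 + dist_T(y, x̄))²·f`
around the block `x̄` of `x`, and `Σ_y e^{−κ′·dist}(1 + dist)² ≤ (2 + 32∕κ′²)·K_{d+1}(κ′∕2)` uniformly in the volume.
HONEST FRAMING (page 1): ABELIAN, FLAT (`U = 1`), LINEAR — the MODEL of ONE-STEP in which the print starts, NOT the non-abelian ONE-STEP (B11
Sects. B–F at a curved background over [Balaban1985BackgroundPropagators] = B11's ref. [5], `U ≠ 1`), NOT NE7.  [folklore] over lit-balaban's kernel theorems; 0 def, 0 sorry.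
Continuum YM on T⁴ ⇐ BetaPertH ∧ nine spine estimates (0/9 proved); BetaPertH ⇐ (D1) ∧ (D4) ∧ CAP+tail; G-an2-4 gates asym, D1 and NE2/3/4;
finite T⁴ rung (B)+1 — NOT infinite volume, NOT mass gap, NOT Clay.
-/

set_option autoImplicit false

noncomputable section

open Finset Matrix

namespace Summit.QuantumFields.BalabanUV.T4Continuum.NE7LinOneStepAbelian

open Literature.MathematicalPhysics.QuantumFieldTheory.Balaban1983to89
open B4TorusKernel (periodConst)
open B4TorusKernel.MultiPeriod (torusSupNorm torusSupNorm_nonneg)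
open B4Sect5Proof (latticeConst latticeConst_nonneg)
open B5Prop11Plancherel (Tor fine fdiff)
open B5Action121 (Fs GradOp fdiff_mulVec_apply)
open B5Block118 (bpt)
open B5Blocks16 (blockOf)
open B5Hk160Torus (constV)
open B6LowerBound2153Torus (toT rep toT_rep)
open B6Cov2156Torus (one_le_M)
open B6Geom246MultiLevelTorus (torusSupNorm_neg)
open B5Hk163Strip (kappa163 kappa163_pos)
open B5Hk163Torus (HkOp)
open B5Hk163TorusHolder (dker fdiff_HkOp_mulVec)
open B5Hk163TorusHolderDecay (CdecD CdecD_nonneg norm_dker_bpt_le)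
open B5Hk163TorusHolderRate (sum_exp_torusSupNorm_sub_rep_le)
open Beta.FluctuationProjection (digitOf bpt_blockOf_digitOf)
open NE7LinOneStepGaugeCovariance (Fs_HkOp_eq_of_sub_eq)
open NE7TorusConeGaugePoincare (coneGauge_exists)

variable {d : ℕ} (n : ℕ) [NeZero n] (M : Fin (d + 1) → ℕ) [hM : ∀ μ, NeZero (M μ)]

/-! ## §1. The polynomial weight against the exponential kernel -/

omit hM in
/-- `(1 + t)²·e^{−at} ≤ (2 + 32∕a²)·e^{−(a∕2)t}` for `t ≥ 0`, `a > 0` (`t² ≤ 16a⁻²e^{at∕2}` from `e^{v} ≥ 1 + v`). [folklore] -/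
theorem sq_mul_exp_le {a t : ℝ} (ha : 0 < a) (ht : 0 ≤ t) :
    (1 + t) ^ 2 * Real.exp (-(a * t)) ≤ (2 + 32 / a ^ 2) * Real.exp (-(a / 2 * t)) := by
  have hv : 0 ≤ a * t / 4 := by positivity
  have h1 : 1 + a * t / 4 ≤ Real.exp (a * t / 4) := by linarith [Real.add_one_le_exp (a * t / 4)]
  have h2 : (a * t / 4) ^ 2 ≤ Real.exp (a / 2 * t) := by
    have e : Real.exp (a / 2 * t) = Real.exp (a * t / 4) ^ 2 := by
      rw [← Real.exp_nat_mul]; congr 1; ring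
    rw [e]
    exact pow_le_pow_left₀ hv (by linarith) 2
  have h3 : t ^ 2 ≤ 16 / a ^ 2 * Real.exp (a / 2 * t) := by
    rw [div_mul_eq_mul_div, le_div_iff₀ (by positivity)]
    nlinarith [h2]
  have h4 : (1 + t) ^ 2 ≤ (2 + 32 / a ^ 2) * Real.exp (a / 2 * t) := by
    have h5 : (1 : ℝ) ≤ Real.exp (a / 2 * t) := Real.one_le_exp (by positivity)
    have h6 : (1 + t) ^ 2 ≤ 2 + 2 * t ^ 2 := by nlinarith [sq_nonneg (1 - t)]
    calc (1 + t) ^ 2 ≤ 2 + 2 * t ^ 2 := h6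
      _ ≤ 2 * Real.exp (a / 2 * t) + 2 * (16 / a ^ 2 * Real.exp (a / 2 * t)) := by linarith
      _ = (2 + 32 / a ^ 2) * Real.exp (a / 2 * t) := by ring
  have e2 : Real.exp (-(a * t)) = Real.exp (-(a / 2 * t)) * Real.exp (-(a / 2 * t)) := by
    rw [← Real.exp_add]; congr 1; ring
  have e3 : Real.exp (a / 2 * t) * Real.exp (-(a / 2 * t)) = 1 := by
    rw [← Real.exp_add, add_neg_cancel, Real.exp_zero]
  calc (1 + t) ^ 2 * Real.exp (-(a * t))
      ≤ (2 + 32 / a ^ 2) * Real.exp (a / 2 * t) * Real.exp (-(a * t)) :=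
        mul_le_mul_of_nonneg_right h4 (Real.exp_pos _).le
    _ = (2 + 32 / a ^ 2) * Real.exp (-(a / 2 * t)) := by rw [e2, ← mul_assoc, mul_assoc (2 + 32 / a ^ 2), e3, mul_one]

/-- **the volume-uniform weighted torus sum**: `Σ_{y ∈ T₁} e^{−a·dist_T(x′,y)}·(1 + dist_T(y,x′))² ≤ (2 + 32∕a²)·K_{d+1}(a∕2)` for every
integer point `x′` and EVERY period vector `M` (lit-balaban's `sum_exp_torusSupNorm_sub_rep_le` at the halved rate). [folklore] -/
theorem sum_exp_sq_le {a : ℝ} (ha : 0 < a) (y₀ : Tor M) :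
    ∑ y : Tor M, Real.exp (-(a * torusSupNorm M (rep M y₀ - rep M y))) * (1 + torusSupNorm M (rep M y - rep M y₀)) ^ 2
      ≤ (2 + 32 / a ^ 2) * latticeConst (d + 1) (a / 2) := by
  have hK := sum_exp_torusSupNorm_sub_rep_le M (half_pos ha) (rep M y₀)
  calc ∑ y : Tor M, Real.exp (-(a * torusSupNorm M (rep M y₀ - rep M y))) * (1 + torusSupNorm M (rep M y - rep M y₀)) ^ 2
      ≤ ∑ y : Tor M, (2 + 32 / a ^ 2) * Real.exp (-(a / 2 * torusSupNorm M (rep M y₀ - rep M y))) := by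
        refine Finset.sum_le_sum fun y _ => ?_
        have hsym : torusSupNorm M (rep M y - rep M y₀) = torusSupNorm M (rep M y₀ - rep M y) := by
          rw [← torusSupNorm_neg (one_le_M M), neg_sub]
        rw [hsym, mul_comm]
        exact sq_mul_exp_le ha (torusSupNorm_nonneg (one_le_M M) _)
    _ ≤ (2 + 32 / a ^ 2) * latticeConst (d + 1) (a / 2) := by
        rw [← Finset.mul_sum]
        exact mul_le_mul_of_nonneg_left hK (by positivity)

/-! ## §2. The derivative kernel against a polynomially growing datum -/

/-- **`|∂_ν(H_kB′)_μ(x)|` against a datum bounded by a WEIGHT `w(y)`**: `≤ CdecD(d)·Σ_y e^{−κ′·dist_T(x̄,y)}·(d+1)·w(y)`, `x̄` the block of `x`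
(the decaying derivative kernel `norm_dker_bpt_le` summed; gen 64's `norm_fdiff_HkOp_mulVec_le_sup` is the constant-weight case). [folklore] -/
theorem norm_fdiff_HkOp_le_weighted (B : Tor M × Fin (d + 1) → ℂ) (w : Tor M → ℝ) (hB : ∀ y lam, ‖B (y, lam)‖ ≤ w y)
    (x : Tor (fine n M)) (μ ν : Fin (d + 1)) :
    ‖(fdiff (fine n M) (n : ℂ) ν *ᵥ (HkOp n M *ᵥ B)) (x, μ)‖
      ≤ CdecD d * ∑ y : Tor M,
          Real.exp (-(kappa163 (d + 1) / (d + 1) * torusSupNorm M (rep M (blockOf n M x) - rep M y))) * (((d : ℝ) + 1) * w y) := by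
  have e : bpt n M (toT M (rep M (blockOf n M x))) (digitOf n M x) = x := by rw [toT_rep, bpt_blockOf_digitOf]
  have hker : ∀ (y : Tor M) (lam : Fin (d + 1)), ‖dker n M μ lam ν x y‖
      ≤ CdecD d * Real.exp (-(kappa163 (d + 1) / (d + 1) * torusSupNorm M (rep M (blockOf n M x) - rep M y))) := by
    intro y lam
    have h2 := norm_dker_bpt_le n M μ lam ν (digitOf n M x) (rep M (blockOf n M x)) (rep M y)
    rw [e, toT_rep] at h2
    exact h2
  have hw : ∀ y, 0 ≤ w y := fun y => (norm_nonneg _).trans (hB y 0)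
  calc ‖(fdiff (fine n M) (n : ℂ) ν *ᵥ (HkOp n M *ᵥ B)) (x, μ)‖
      ≤ ∑ y : Tor M, ∑ lam : Fin (d + 1), ‖dker n M μ lam ν x y‖ * ‖B (y, lam)‖ := by
        rw [fdiff_HkOp_mulVec]
        refine (norm_sum_le _ _).trans (Finset.sum_le_sum fun y _ => ?_)
        refine (norm_sum_le _ _).trans (Finset.sum_le_sum fun lam _ => ?_)
        rw [norm_mul]
    _ ≤ ∑ y : Tor M, ∑ _lam : Fin (d + 1),
          CdecD d * Real.exp (-(kappa163 (d + 1) / (d + 1) * torusSupNorm M (rep M (blockOf n M x) - rep M y))) * w y :=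
        Finset.sum_le_sum fun y _ => Finset.sum_le_sum fun lam _ =>
          mul_le_mul (hker y lam) (hB y lam) (norm_nonneg _) (mul_nonneg CdecD_nonneg (Real.exp_pos _).le)
    _ = CdecD d * ∑ y : Tor M,
          Real.exp (-(kappa163 (d + 1) / (d + 1) * torusSupNorm M (rep M (blockOf n M x) - rep M y))) * (((d : ℝ) + 1) * w y) := by
        rw [Finset.mul_sum]
        refine Finset.sum_congr rfl fun y _ => ?_
        simp only [Finset.sum_const, Finset.card_univ, Fintype.card_fin, nsmul_eq_mul]
        push_cast; ring

/-! ## §3. LIN-ONE-STEP -/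

/-- curvature = antisymmetrised derivative: `F_{μν}(A)(x) = (∇_μA)_ν(x) − (∇_νA)_μ(x)`. [folklore] -/
theorem Fs_eq_fdiff_sub {N : Fin (d + 1) → ℕ} [∀ μ, NeZero (N μ)] (c : ℂ) (A : Tor N × Fin (d + 1) → ℂ) (μ ν : Fin (d + 1)) (x : Tor N) :
    Fs N c A μ ν x = (fdiff N c μ *ᵥ A) (x, ν) - (fdiff N c ν *ᵥ A) (x, μ) := by
  rw [fdiff_mulVec_apply, fdiff_mulVec_apply]
  rfl

/-- **LIN-ONE-STEP (abelian flat ONE-STEP, curvature to curvature)**: for every coarse field `B` on `T₁` with `|F_{μν}(B)| ≤ f` and every fine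
point `x`, `|F_{μν}(H_kB)(x)| ≤ C_LIN(d)·f`, `C_LIN(d) = 2·CdecD(d)·(d+1)·(2(d+1))·(2 + 32∕κ′²)·K_{d+1}(κ′∕2)`, `κ′ = κ₁₆₃(d+1)∕(d+1)` — a constant of
the DIMENSION ONLY, uniform in the level `n = L^k` and in the volume `M`: the linear constrained minimiser spreads the coarse flux evenly
([Balaban1985Variational] Thm 1 (8) in the linearised `U = 1` model; proof = gauge covariance (file A) + cone gauge (file B2b) + kernel decay
([Balaban1984PropagatorsII] Cor. 2.8, lit-balaban)).  UNITS ([Balaban1984PropagatorsI] (1.1)–(1.2)): `A_μ(x)` is the field VALUE on the bond and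
`F(p) = η⁻¹(A + A − A − A)` (`Fs … (n : ℂ)`, `η⁻¹ = n`), so the plaquette ANGLE of `U = e^{iηA}` is `η·(A + A − A − A) = η²F(p)`: the bound reads
`|U_min(∂p) − 1| ≲ C_LIN·f·η²` against the datum's `|V(∂p′) − 1| ≲ f` on the unit lattice — the shape `B₃ε₁η²` of (8) with `B₃ ↤ C_LIN(d)`,
`ε₁ ↤ f`. [folklore] -/
theorem norm_curl_HkOp_le_curl (B : Tor M × Fin (d + 1) → ℂ) {f : ℝ} (hF : ∀ y (μ ν : Fin (d + 1)), ‖Fs M 1 B μ ν y‖ ≤ f)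
    (x : Tor (fine n M)) (μ ν : Fin (d + 1)) :
    ‖Fs (fine n M) (n : ℂ) (HkOp n M *ᵥ B) μ ν x‖
      ≤ 2 * (CdecD d * (((d : ℝ) + 1) * (2 * ((d : ℝ) + 1))
          * ((2 + 32 / (kappa163 (d + 1) / (d + 1)) ^ 2) * latticeConst (d + 1) (kappa163 (d + 1) / (d + 1) / 2)))) * f := by
  have hκ : 0 < kappa163 (d + 1) / (d + 1) := div_pos (kappa163_pos (d + 1)) (by positivity)
  have hf : 0 ≤ f := (norm_nonneg _).trans (hF 0 0 0)
  -- the cone gauge around the block of `x`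
  obtain ⟨m, a, hB'⟩ := coneGauge_exists M B (blockOf n M x) hF
  set B' : Tor M × Fin (d + 1) → ℂ := B - GradOp M 1 *ᵥ m - constV M a with hB'def
  have hsub : B - B' = GradOp M 1 *ᵥ m + constV M a := by
    rw [hB'def]; abel
  have hB'w : ∀ y lam, ‖B' (y, lam)‖
      ≤ 2 * ((d : ℝ) + 1) * (1 + torusSupNorm M (rep M y - rep M (blockOf n M x))) ^ 2 * f := by
    intro y lam
    have h := hB' y lam
    simpa only [hB'def, Pi.sub_apply] using h
  -- gauge covariance: the curvature of `H_kB` is that of `H_kB′`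
  rw [Fs_HkOp_eq_of_sub_eq n M B B' m a hsub x μ ν, Fs_eq_fdiff_sub]
  -- each derivative term against the polynomially growing `B′`
  have hterm : ∀ μ' ν' : Fin (d + 1), ‖(fdiff (fine n M) (n : ℂ) ν' *ᵥ (HkOp n M *ᵥ B')) (x, μ')‖
      ≤ CdecD d * (((d : ℝ) + 1) * (2 * ((d : ℝ) + 1))
          * ((2 + 32 / (kappa163 (d + 1) / (d + 1)) ^ 2) * latticeConst (d + 1) (kappa163 (d + 1) / (d + 1) / 2))) * f := by
    intro μ' ν'
    refine (norm_fdiff_HkOp_le_weighted n M B' _ hB'w x μ' ν').trans ?_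
    have hS := sum_exp_sq_le M hκ (blockOf n M x)
    have e : ∑ y : Tor M, Real.exp (-(kappa163 (d + 1) / (d + 1) * torusSupNorm M (rep M (blockOf n M x) - rep M y)))
          * (((d : ℝ) + 1) * (2 * ((d : ℝ) + 1) * (1 + torusSupNorm M (rep M y - rep M (blockOf n M x))) ^ 2 * f))
        = ((d : ℝ) + 1) * (2 * ((d : ℝ) + 1)) * f * ∑ y : Tor M,
            Real.exp (-(kappa163 (d + 1) / (d + 1) * torusSupNorm M (rep M (blockOf n M x) - rep M y)))
              * (1 + torusSupNorm M (rep M y - rep M (blockOf n M x))) ^ 2 := by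
      rw [Finset.mul_sum]
      refine Finset.sum_congr rfl fun y _ => ?_
      ring
    rw [e]
    have hpos : 0 ≤ ((d : ℝ) + 1) * (2 * ((d : ℝ) + 1)) * f := by positivity
    calc CdecD d * (((d : ℝ) + 1) * (2 * ((d : ℝ) + 1)) * f * ∑ y : Tor M,
            Real.exp (-(kappa163 (d + 1) / (d + 1) * torusSupNorm M (rep M (blockOf n M x) - rep M y)))
              * (1 + torusSupNorm M (rep M y - rep M (blockOf n M x))) ^ 2)
        ≤ CdecD d * (((d : ℝ) + 1) * (2 * ((d : ℝ) + 1)) * f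
            * ((2 + 32 / (kappa163 (d + 1) / (d + 1)) ^ 2) * latticeConst (d + 1) (kappa163 (d + 1) / (d + 1) / 2))) :=
          mul_le_mul_of_nonneg_left (mul_le_mul_of_nonneg_left hS hpos) CdecD_nonneg
      _ = _ := by ring
  calc ‖(fdiff (fine n M) (n : ℂ) μ *ᵥ (HkOp n M *ᵥ B')) (x, ν) - (fdiff (fine n M) (n : ℂ) ν *ᵥ (HkOp n M *ᵥ B')) (x, μ)‖
      ≤ ‖(fdiff (fine n M) (n : ℂ) μ *ᵥ (HkOp n M *ᵥ B')) (x, ν)‖ + ‖(fdiff (fine n M) (n : ℂ) ν *ᵥ (HkOp n M *ᵥ B')) (x, μ)‖ :=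
        norm_sub_le _ _
    _ ≤ _ := by have h1 := hterm ν μ; have h2 := hterm μ ν; linarith

/-! ## §4. The converse: the datum's curvature is bounded by the minimiser's (sup form of Federbush's stability) -/

/-- **sup-form abelian stability of the block average**: if `Q_kA = B` then `|F¹_{μν}(B)(y)| ≤ sup_x |F^η_{μν}(A)(x)|` with constant
EXACTLY `1` — the coarse plaquette variable is `η^{d+1}` times the sum over the `n^d` base points of the block of the `n²` fine plaquette
variables of a unit square (lit-balaban's `B5AverageCurlStokes.plaq_eq_of_QvOp_eq`, [Federbush1986PhaseCellI] (1.3)–(1.4) for the typed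
`Q_k`), and `F^η = η⁻¹·plaq`. [folklore] -/
theorem norm_curl_le_of_QvOp_eq (A : Tor (fine n M) × Fin (d + 1) → ℂ) (B : Tor M × Fin (d + 1) → ℂ) (hB : B5Block118.QvOp n M *ᵥ A = B)
    {g : ℝ} (hA : ∀ x (μ ν : Fin (d + 1)), ‖Fs (fine n M) (n : ℂ) A μ ν x‖ ≤ g) (y : Tor M) (μ ν : Fin (d + 1)) :
    ‖Fs M 1 B μ ν y‖ ≤ g := by
  have hn : (0 : ℝ) < n := by exact_mod_cast Nat.pos_of_ne_zero (NeZero.ne n)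
  have hg : 0 ≤ g := (norm_nonneg _).trans (hA 0 0 0)
  -- each fine plaquette variable is `F^η ∕ n`
  have hplaq : ∀ x, ‖B5AverageCurlStokes.plaq (fine n M) A μ ν x‖ ≤ g / n := by
    intro x
    have h := hA x μ ν
    rw [B5AverageCurlStokes.Fs_eq_mul_plaq, norm_mul, Complex.norm_natCast] at h
    rw [le_div_iff₀ hn]; linarith [mul_comm (n : ℝ) ‖B5AverageCurlStokes.plaq (fine n M) A μ ν x‖]
  have hsq : ∀ x, ‖B5AverageCurlStokes.squareSum n M A μ ν x‖ ≤ (n : ℝ) * n * (g / n) := by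
    intro x
    unfold B5AverageCurlStokes.squareSum
    refine (norm_sum_le _ _).trans ?_
    calc ∑ s : Fin n, ‖∑ t : Fin n, B5AverageCurlStokes.plaq (fine n M) A μ ν (x + B5Block118.tstep (fine n M) μ s
            + B5Block118.tstep (fine n M) ν t)‖
        ≤ ∑ _s : Fin n, ∑ _t : Fin n, g / n :=
          Finset.sum_le_sum fun s _ => (norm_sum_le _ _).trans (Finset.sum_le_sum fun t _ => hplaq _)
      _ = (n : ℝ) * n * (g / n) := by simp only [Finset.sum_const, Finset.card_univ, Fintype.card_fin, nsmul_eq_mul]; ring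
  rw [B5AverageCurlStokes.Fs_eq_mul_plaq, one_mul, B5AverageCurlStokes.plaq_eq_of_QvOp_eq n M A B hB, norm_mul]
  have hnorm : ‖(1 / (n : ℂ) ^ (d + 1 + 1))‖ = 1 / (n : ℝ) ^ (d + 1 + 1) := by
    rw [norm_div, norm_one, norm_pow, Complex.norm_natCast]
  rw [hnorm]
  calc 1 / (n : ℝ) ^ (d + 1 + 1) * ‖∑ j : Fin (d + 1) → Fin n, B5AverageCurlStokes.squareSum n M A μ ν (bpt n M y j)‖
      ≤ 1 / (n : ℝ) ^ (d + 1 + 1) * ∑ j : Fin (d + 1) → Fin n, (n : ℝ) * n * (g / n) := by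
        refine mul_le_mul_of_nonneg_left ((norm_sum_le _ _).trans (Finset.sum_le_sum fun j _ => hsq _)) (by positivity)
    _ = g := by
        rw [Finset.sum_const, Finset.card_univ, Fintype.card_pi, Finset.prod_const, Fintype.card_fin, Finset.card_univ,
          Fintype.card_fin, nsmul_eq_mul]
        field_simp
        push_cast
        ring

/-- **LIN-ONE-STEP IS TWO-SIDED**: the datum's curvature is bounded by the sup of the minimiser's curvature, `sup|F¹(B)| ≤ sup|F^η(H_kB)|`
(so `C_LIN(d) ≥ 1` is forced, and the curvature of the constrained minimiser is COMPARABLE to the curvature of its datum): `Q_kH_kB = B`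
(lit-balaban's `B5Hk163Torus.QvOp_HkOp_mulVec`) and the sup-form stability above. [folklore] -/
theorem norm_curl_le_sup_curl_HkOp (B : Tor M × Fin (d + 1) → ℂ) {g : ℝ}
    (hg : ∀ x (μ ν : Fin (d + 1)), ‖Fs (fine n M) (n : ℂ) (HkOp n M *ᵥ B) μ ν x‖ ≤ g) (y : Tor M) (μ ν : Fin (d + 1)) :
    ‖Fs M 1 B μ ν y‖ ≤ g :=
  norm_curl_le_of_QvOp_eq n M (HkOp n M *ᵥ B) B (B5Hk163Torus.QvOp_HkOp_mulVec n M B) hg y μ ν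

end Summit.QuantumFields.BalabanUV.T4Continuum.NE7LinOneStepAbelian
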